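import Literature.Computability.AlgebraicComplexity.BLMW11PermanentApproximationEquivalence
import Literature.Computability.AlgebraicComplexity.BLMW11VPwsBarSubsetVPBar
import HarnessLib

/-!
# BLMW 2011 §9.2–§9.3: the weak Valiant hypothesis `VP_ws ≠ VNP` — `dc` versus `L_ws`, the
permanent as a p-projection of the determinant, and "Conjecture [MS] would imply `VP_ws ≠ VNP`"

Bürgisser–Landsberg–Manivel–Weyman 2011 (arXiv:0907.2850, p. 21): "It is natural to weaken
Valiant's hypothesis to `VP_ws ≠ VNP`. In view of the completeness of the sequences of
determinants and permanents in `VP_ws` and `VNP`, respectively, `VP_ws ≠ VNP` is logically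
equivalent to the claim that `(per_n)` is not a p-projection of `(det_n)`." and (before the proof of
Prop. 9.3.2) "we note that Conjecture [MS] would imply that `VP_ws ≠ VNP` (but not a priori
`VP ≠ VNP`)."

This file connects the tree's determinantal-complexity form of Valiant's hypothesis
(`DcPerSuperpolynomial ℂ`, `PermanentVsDeterminant.lean`) with the class language of
`BLMW11KroneckerApproximation.lean` (`IsVPwsFamily`), all statements PROVED:

* `eq_C_add_sum_smul_X_of_totalDegree_le_one` — an affine polynomial is `a₀ + ∑_t a_t x_t`;
* `wsComplexity_le_of_hasDetRepr` — **`L_ws(f) ≤ ((N+2)(4N³+7)² + N²)(2·#σ + 3)` if `dc(f) ≤ N`**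
  (substitute the affine entries into the skew det circuit, `SkewCircuitAffineSubstitution.lean`);
  `hasDetRepr_of_wsComplexity_le` — **`dc(f) ≤ 12·L_ws(f) + 1`** (universality, via the tree's
  (iii) `ArithCircuit.skewComplexity_le_four_mul_wsComplexity` and skew universality);
* `isVPwsFamily_perPoly_iff_isPBounded_dc`, **`dcPerSuperpolynomial_iff_not_isVPwsFamily_perPoly`**:
  `DcPerSuperpolynomial ℂ ↔ (per_m) ∉ VP_ws`;
* `isVPwsFamily_perPoly_iff_isPProjection_detPoly`,
  **`dcPerSuperpolynomial_iff_not_isPProjection_perPoly_detPoly`** and the class form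
  **`vnp_subset_vpws_iff_isPProjection_perPoly_detPoly`** ("`VP_ws ≠ VNP` is logically equivalent
  to the claim that `(per_n)` is not a p-projection of `(det_n)`"), by the completeness theorems of
  the tree: `BLMW2011_sec9_detVPws_holds` (det in `VP_ws`) and `isVNPComplete_perPoly_holds ℂ`;
* **`not_isVPwsFamily_perPoly_of_borderDcPerSuperpolynomial`**,
  **`dcPerSuperpolynomial_of_borderDcPerSuperpolynomial`** — "Conjecture [MS] would imply
  `VP_ws ≠ VNP`", from `BLMW2011_prop_9_3_2_holds`;
* `dcPerSuperpolynomial_of_perNotPComputableComplex`, `vnp_subset_vp_of_vnp_subset_vpws` — "It is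
  natural to weaken Valiant's hypothesis to `VP_ws ≠ VNP`": the registered form
  `PerNotPComputableComplex` of `VP_ℂ ≠ VNP_ℂ` implies `DcPerSuperpolynomial ℂ` (`L ≤ L_ws`).

Theorems only; cell `val-lit`, seat t14. Nothing here asserts any of the open hypotheses.

## References
* [BLMW 2011] SIAM J. Comput. 40 (2011), §9.2–§9.3 (arXiv p. 21). Bib key `BurgisserEtAl2011`.
-/

open MvPolynomial

namespace Literature.Computability.AlgebraicComplexity

/-! ### `dc` versus `L_ws` -/

section DcWs

/-- An affine polynomial (`totalDegree ≤ 1`) over `ℂ` is `a₀ + ∑_t a_t • x_t` with `a₀ = coeff 0`,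
`a_t = coeff (single t 1)` (polynomial form of `eval_eq_of_totalDegree_le_one`).
[cite: MignonRessayre2004, §1] -/
theorem eq_C_add_sum_smul_X_of_totalDegree_le_one {τ : Type*} [Fintype τ] [DecidableEq τ]
    {a : MvPolynomial τ ℂ} (ha : a.totalDegree ≤ 1) :
    a = C (coeff 0 a) + ∑ t, coeff (Finsupp.single t 1) a • X t := by
  apply MvPolynomial.funext
  intro x
  rw [eval_eq_of_totalDegree_le_one ha, map_add, eval_C, map_sum]
  congr 1
  refine Finset.sum_congr rfl fun t _ => ?_
  rw [smul_eval, eval_X]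

/-- **`L_ws(f) ≤ ((N+2)(4N³+7)² + N²)·(2·#σ + 3)` whenever `dc(f) ≤ N`** (BLMW 2011 §9.1–§9.2: the
determinant has small weakly-skew circuits, and an affine determinantal representation is an
affine substitution into `det_N` — substituted into the tree's SKEW det circuit by
`SkewSubst.exists_skew_affineSubst` / `wsComplexity_aeval_affine_le`).
[cite: BurgisserEtAl2011, §9.1–§9.2 (det ∈ VP_ws; universality of the determinant)] -/
theorem wsComplexity_le_of_hasDetRepr {σ : Type*} [Fintype σ] [DecidableEq σ]
    {f : MvPolynomial σ ℂ} {N : ℕ} (h : HasDetRepr f N) :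
    wsComplexity f ≤ ((N + 2) * (4 * N ^ 3 + 7) ^ 2 + N * N) * (2 * Fintype.card σ + 3) := by
  classical
  obtain ⟨A, hAdeg, hAdet⟩ := h
  -- the affine substitution data
  set a0 : Fin N × Fin N → ℂ := fun ij => coeff 0 (A ij.1 ij.2) with ha0
  set Ac : Fin N × Fin N → σ → ℂ := fun ij t => coeff (Finsupp.single t 1) (A ij.1 ij.2) with hAc
  have hentry : ∀ ij : Fin N × Fin N,
      ArithCircuit.SkewSubst.psi a0 Ac ij = A ij.1 ij.2 := by
    intro ij
    rw [ArithCircuit.SkewSubst.psi, ha0, hAc]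
    exact (eq_C_add_sum_smul_X_of_totalDegree_le_one (hAdeg ij.1 ij.2)).symm
  have hpsi : ArithCircuit.SkewSubst.psi a0 Ac = fun p : Fin N × Fin N => A p.1 p.2 :=
    funext hentry
  have hf : f = aeval (ArithCircuit.SkewSubst.psi a0 Ac) (detPoly (Fin N) ℂ) := by
    rw [hpsi, detPoly, AlgHom.map_det, Matrix.mvPolynomialX_mapMatrix_aeval, hAdet]
  rw [hf]
  refine (wsComplexity_aeval_affine_le a0 Ac _).trans ?_
  have hc : Fintype.card (Fin N × Fin N) = N * N := by simp
  rw [hc]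
  exact Nat.mul_le_mul_right _ (Nat.add_le_add_right (skewComplexity_detPoly_le ℂ N) _)

/-- **`dc(f) ≤ 12·L_ws(f) + 1`** (BLMW 2011 §9.2, "if `L_ws(f) ≤ m` then `f` is a projection of
`det_{m+1}`", for the tree's gate count): conjunct (iii) with constant `4`
(`ArithCircuit.skewComplexity_le_four_mul_wsComplexity`) and skew universality
(`hasDetRepr_of_wsComplexity_le_of_skew_le_ws`). [cite: BurgisserEtAl2011, §9.2 (universality of the determinant)] -/
theorem hasDetRepr_of_wsComplexity_le {σ : Type} [Fintype σ] (f : MvPolynomial σ ℂ) {r : ℕ}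
    (h : wsComplexity f ≤ r) : HasDetRepr f (3 * (4 * r) + 1) :=
  hasDetRepr_of_wsComplexity_le_of_skew_le_ws 4
    (fun g => ArithCircuit.skewComplexity_le_four_mul_wsComplexity g) f h

/-- **`(per_m) ∈ VP_ws ↔ dc(per_m)` is p-bounded.** [cite: BurgisserEtAl2011, §9.2 (VP_ws ≠ VNP ⟺ per not a p-projection of det)] -/
theorem isVPwsFamily_perPoly_iff_isPBounded_dc :
    IsVPwsFamily (fun m => perPoly (Fin m) ℂ) ↔
      IsPBounded fun m => determinantalComplexity (perPoly (Fin m) ℂ) := by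
  constructor
  · rintro ⟨c, hc⟩
    refine IsPBounded.mono (t := fun m => 3 * (4 * (m ^ c + c)) + 1)
      (IsPBounded.add_holds (IsPBounded.mul_holds (IsPBounded.const 3) (IsPBounded.mul_holds
        (IsPBounded.const 4) (IsPBounded.add_holds (IsPBounded.pow_holds IsPBounded.id c)
        (IsPBounded.const c)))) (IsPBounded.const 1)) fun m => ?_
    exact determinantalComplexity_le_of_hasDetRepr (hasDetRepr_of_wsComplexity_le _ (hc m))
  · rintro ⟨c, hc⟩
    refine IsPBounded.mono (t := fun m => (((m ^ c + c) + 2) * (4 * (m ^ c + c) ^ 3 + 7) ^ 2 +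
        (m ^ c + c) * (m ^ c + c)) * (2 * (m * m) + 3)) ?_ fun m => ?_
    · have hr : IsPBounded fun m => m ^ c + c :=
        IsPBounded.add_holds (IsPBounded.pow_holds IsPBounded.id c) (IsPBounded.const c)
      exact IsPBounded.mul_holds (IsPBounded.add_holds (IsPBounded.mul_holds
        (IsPBounded.add_holds hr (IsPBounded.const 2)) (IsPBounded.pow_holds (IsPBounded.add_holds
        (IsPBounded.mul_holds (IsPBounded.const 4) (IsPBounded.pow_holds hr 3)) (IsPBounded.const 7))
        2)) (IsPBounded.mul_holds hr hr)) (IsPBounded.add_holds (IsPBounded.mul_holds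
        (IsPBounded.const 2) (IsPBounded.mul_holds IsPBounded.id IsPBounded.id)) (IsPBounded.const 3))
    · have hrepr : HasDetRepr (perPoly (Fin m) ℂ) (m ^ c + c) :=
        HasDetRepr.mono_holds (hasDetRepr_determinantalComplexity_holds _) (hc m)
      have h := wsComplexity_le_of_hasDetRepr hrepr
      have hcard : Fintype.card (Fin m × Fin m) = m * m := by simp
      rw [hcard] at h
      exact h

/-- **Valiant's hypothesis (determinantal form) ⟺ `(per_m) ∉ VP_ws`**: the tree's
`DcPerSuperpolynomial ℂ` is the statement `(per_m) ∉ VP_ws` of BLMW 2011 §9.2.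
[cite: BurgisserEtAl2011, §9.2 (VP_ws ≠ VNP ⟺ per not a p-projection of det)] -/
theorem dcPerSuperpolynomial_iff_not_isVPwsFamily_perPoly :
    DcPerSuperpolynomial ℂ ↔ ¬ IsVPwsFamily (fun m => perPoly (Fin m) ℂ) := by
  unfold DcPerSuperpolynomial
  rw [isVPwsFamily_perPoly_iff_isPBounded_dc]

end DcWs

/-! ### `(per_m) ∈ VP_ws` ⟺ `(per_m)` is a p-projection of `(det_n)` ⟺ `VNP ⊆ VP_ws` -/

section Projections

/-- **`(per_m) ∈ VP_ws ↔ (per_m)` is a p-projection of `(det_n)`** ("in view of the completeness of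
the sequence of determinants in `VP_ws`", BLMW 2011 §9.2): `⇐` by `det ∈ VP_ws` and closure under
p-projections; `⇒` by the `VP_ws`-universality of the determinant (conjunct (ii) of
`BLMW2011_sec9_detVPws_holds`, stated for variables `Fin (v n)`, transported along
`Fin m × Fin m ≃ Fin (m·m)`). [cite: BurgisserEtAl2011, §9.2 (VP_ws ≠ VNP ⟺ per not a p-projection of det)] -/
theorem isVPwsFamily_perPoly_iff_isPProjection_detPoly :
    IsVPwsFamily (fun m => perPoly (Fin m) ℂ) ↔
      IsPProjection (fun m => perPoly (Fin m) ℂ) (fun n => detPoly (Fin n) ℂ) := by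
  constructor
  · intro hper
    -- transport to variables `Fin (m·m)`
    have hper' : IsVPwsFamily (fun m => rename (finProdFinEquiv (m := m) (n := m))
        (perPoly (Fin m) ℂ)) := by
      unfold IsVPwsFamily at hper ⊢
      simpa only [wsComplexity_rename_equiv] using hper
    have hproj' := BLMW2011_sec9_detVPws_holds.2.1 (fun m => m * m) _ hper'
    -- `per_m` is a projection of its renaming
    have hback : IsPProjection (fun m => perPoly (Fin m) ℂ)
        (fun m => rename (finProdFinEquiv (m := m) (n := m)) (perPoly (Fin m) ℂ)) := by
      refine ⟨_root_.id, IsPBounded.id, fun m => ?_⟩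
      have h := isProjection_rename (finProdFinEquiv (m := m) (n := m)).symm
        (rename (finProdFinEquiv (m := m) (n := m)) (perPoly (Fin m) ℂ))
      rwa [rename_rename, Equiv.symm_comp_self, rename_id] at h
    exact IsPProjection.trans_holds hback hproj'
  · intro h
    exact IsVPwsFamily.of_isPProjection (HI16Skew.isVPwsFamily_detPoly ℂ) h

/-- **Valiant's hypothesis (determinantal form) ⟺ `(per_m)` is not a p-projection of `(det_n)`**
over `ℂ` (BLMW 2011 §9.2: "`VP_ws ≠ VNP` is logically equivalent to the claim that `(per_n)` is not
a p-projection of `(det_n)`"; Toda / Malod–Portier universality as recorded in the docstring of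
`DcPerSuperpolynomial`). [cite: BurgisserEtAl2011, §9.2 (VP_ws ≠ VNP ⟺ per not a p-projection of det)] -/
theorem dcPerSuperpolynomial_iff_not_isPProjection_perPoly_detPoly :
    DcPerSuperpolynomial ℂ ↔
      ¬ IsPProjection (fun m => perPoly (Fin m) ℂ) (fun n => detPoly (Fin n) ℂ) := by
  rw [dcPerSuperpolynomial_iff_not_isVPwsFamily_perPoly, isVPwsFamily_perPoly_iff_isPProjection_detPoly]

/-- **BLMW 2011 §9.2: `VNP ⊆ VP_ws` ⟺ `(per_m)` is a p-projection of `(det_n)`** (the class form of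
"`VP_ws ≠ VNP` is logically equivalent to the claim that `(per_n)` is not a p-projection of
`(det_n)`"; `VNP` families in variables `Fin (v n)` as in the tree's `IsVNPComplete`; Valiant's
completeness of the permanent `isVNPComplete_perPoly_holds ℂ` and the `VNP`-membership
`isVNPFamily_perPoly_holds ℂ`). [cite: BurgisserEtAl2011, §9.2 (VP_ws ≠ VNP ⟺ per not a p-projection of det)] -/
theorem vnp_subset_vpws_iff_isPProjection_perPoly_detPoly :
    (∀ (v : ℕ → ℕ) (f : ∀ n, MvPolynomial (Fin (v n)) ℂ), IsVNPFamily f → IsVPwsFamily f) ↔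
      IsPProjection (fun m => perPoly (Fin m) ℂ) (fun n => detPoly (Fin n) ℂ) := by
  rw [← isVPwsFamily_perPoly_iff_isPProjection_detPoly]
  constructor
  · intro H
    have hvnp : IsVNPFamily (fun n => rename (finProdFinEquiv (m := n) (n := n))
        (perPoly (Fin n) ℂ)) := by
      have h := (isVNPFamily_renameEquiv_iff (σ := fun n => Fin n × Fin n)
        (fun n => finProdFinEquiv (m := n) (n := n)) (fun n => perPoly (Fin n) ℂ)).2
        (isVNPFamily_perPoly_holds ℂ)
      simpa only [renameEquiv_apply] using h
    have h := H (fun n => n * n) _ hvnp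
    unfold IsVPwsFamily at h ⊢
    simpa only [wsComplexity_rename_equiv] using h
  · intro hper v f hf
    have hchar : ringChar ℂ ≠ 2 := by rw [ringChar.eq_zero]; norm_num
    exact IsVPwsFamily.of_isPProjection hper (((isVNPComplete_perPoly_holds ℂ) hchar).2 v f hf)

/-- Class form of Valiant's weak hypothesis: **`DcPerSuperpolynomial ℂ ↔ VNP ⊄ VP_ws`**.
[cite: BurgisserEtAl2011, §9.2 (VP_ws ≠ VNP ⟺ per not a p-projection of det)] -/
theorem dcPerSuperpolynomial_iff_not_vnp_subset_vpws :
    DcPerSuperpolynomial ℂ ↔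
      ¬ ∀ (v : ℕ → ℕ) (f : ∀ n, MvPolynomial (Fin (v n)) ℂ), IsVNPFamily f → IsVPwsFamily f := by
  rw [dcPerSuperpolynomial_iff_not_isPProjection_perPoly_detPoly,
    vnp_subset_vpws_iff_isPProjection_perPoly_detPoly]

end Projections

/-! ### "Conjecture [MS] would imply `VP_ws ≠ VNP`" -/

section MS

/-- **BLMW 2011 §9.3: the Mulmuley–Sohoni "no constant `c`" conjecture implies
`(per_m) ∉ VP_ws`** (`VP_ws ⊆ \overline{VP_ws}` and Prop. 9.3.2). [cite: BurgisserEtAl2011, §9.3 (MS ⇒ VP_ws ≠ VNP)] -/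
theorem not_isVPwsFamily_perPoly_of_borderDcPerSuperpolynomial (h : BorderDcPerSuperpolynomial) :
    ¬ IsVPwsFamily (fun m => perPoly (Fin m) ℂ) :=
  fun hws => (BLMW2011_prop_9_3_2_holds.1.mp h) hws.isVPwsBarFamily

/-- **BLMW 2011 §9.3: "Conjecture [MS] would imply that `VP_ws ≠ VNP` (but not a priori
`VP ≠ VNP`)"** — in the tree's determinantal language: the border ("no constant `c`") conjecture
`BorderDcPerSuperpolynomial` implies Valiant's hypothesis in `dc` form, `DcPerSuperpolynomial ℂ`.
[cite: BurgisserEtAl2011, §9.3 (MS ⇒ VP_ws ≠ VNP)] -/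
theorem dcPerSuperpolynomial_of_borderDcPerSuperpolynomial (h : BorderDcPerSuperpolynomial) :
    DcPerSuperpolynomial ℂ :=
  dcPerSuperpolynomial_iff_not_isVPwsFamily_perPoly.mpr
    (not_isVPwsFamily_perPoly_of_borderDcPerSuperpolynomial h)

end MS

/-! ### "It is natural to weaken Valiant's hypothesis to `VP_ws ≠ VNP`": `VP ≠ VNP ⇒ VP_ws ≠ VNP` -/

section Weakening

/-- **BLMW 2011 §9.2: "It is natural to weaken Valiant's hypothesis to `VP_ws ≠ VNP`."** In the
tree's vocabulary: Valiant's hypothesis over `ℂ` in its registered form `PerNotPComputableComplex`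
(`(per_n)` is not p-computable, `ValiantConjecture.lean`) implies the weak form
`DcPerSuperpolynomial ℂ` (`(per_m) ∉ VP_ws`, equivalently `VNP ⊄ VP_ws`,
`dcPerSuperpolynomial_iff_not_vnp_subset_vpws`), because `L(f) ≤ L_ws(f)` (`VP_ws ⊆ VP`, §9.1).
An implication between two OPEN statements; nothing is asserted. [cite: BurgisserEtAl2011, §9.2 (weakening Valiant's hypothesis to VP_ws ≠ VNP)] -/
theorem dcPerSuperpolynomial_of_perNotPComputableComplex (h : PerNotPComputableComplex) :
    DcPerSuperpolynomial ℂ :=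
  dcPerSuperpolynomial_iff_not_isVPwsFamily_perPoly.mpr fun hws => h hws.isPBounded_complexity

/-- Class form of the weakening (BLMW 2011 §9.1 "`VP_ws ⊆ VP`", §9.2): `VNP ⊆ VP_ws ⇒ VNP ⊆ VP`
over `ℂ`, for families in the variables `Fin (v n)` — contrapositively `VP ≠ VNP ⇒ VP_ws ≠ VNP`.
(A `VNP` family is a p-family, and `L ≤ L_ws`.) [cite: BurgisserEtAl2011, §9.1–9.2 (VP_ws ⊆ VP; weakening)] -/
theorem vnp_subset_vp_of_vnp_subset_vpws
    (h : ∀ (v : ℕ → ℕ) (f : ∀ n, MvPolynomial (Fin (v n)) ℂ), IsVNPFamily f → IsVPwsFamily f)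
    (v : ℕ → ℕ) (f : ∀ n, MvPolynomial (Fin (v n)) ℂ) (hf : IsVNPFamily f) : IsVPFamily f :=
  ⟨hf.1, (h v f hf).isPBounded_complexity⟩

/-- The two roads to the weak hypothesis recorded in BLMW 2011 §9.2–§9.3, side by side: Valiant's
hypothesis `(per_n) ∉ VP_ℂ` and the Mulmuley–Sohoni border conjecture `BorderDcPerSuperpolynomial`
EACH imply `DcPerSuperpolynomial ℂ` (`VP_ws ≠ VNP`); "but not a priori `VP ≠ VNP`" from [MS].
[cite: BurgisserEtAl2011, §9.2–9.3] -/
theorem dcPerSuperpolynomial_of_perNotPComputableComplex_or_border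
    (h : PerNotPComputableComplex ∨ BorderDcPerSuperpolynomial) : DcPerSuperpolynomial ℂ :=
  h.elim dcPerSuperpolynomial_of_perNotPComputableComplex
    dcPerSuperpolynomial_of_borderDcPerSuperpolynomial

end Weakening

end Literature.Computability.AlgebraicComplexity
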